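import Mathlib
import HarnessLib
import HarnessLib.Audit
import Summits.ValiantsHypothesis.Statement
import Literature.Computability.AlgebraicComplexity.DeterminantalComplexity
import Literature.Computability.AlgebraicComplexity.DeterminantalComplexityProofs
import Literature.Computability.AlgebraicComplexity.EquivariantDC
import Literature.Computability.AlgebraicComplexity.LandsbergRessayre
import Literature.Computability.AlgebraicComplexity.AlperBogartVelascoSubspace
import Literature.Computability.AlgebraicComplexity.AlperBogartVelascoBoxThree
import Literature.Computability.AlgebraicComplexity.ValiantConjectureProofs
import Summits.ValiantsHypothesis.ValiantsHypothesis.Theorems.HubHub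

/-!
Route: ProjectionStability

CLOSED (refuted) 2026-08-17T12:49:15Z by planner-rfix-ValiantsHypothesis-ProjectionSt-9b502ec7-0 — reason: refuted:stmt-ValiantsHypothesis-17836 (UniqBase) by Summit.ValiantsHypothesis.ValiantsHypothesis.Theorems.not_UniqBase — note: route-repair (planner-rfix-…-9b502ec7): CLOSED refuted:UniqBase — SUBSTANTIVE, no honest repair inside this line. Kill: Grenet's 7×7 gA vs its purified single-syzygy Koszul twist K (constants 0,±1, det = per_3, size 7 = pdc(per_3)): two GL_7(ℂ)²×permSymmetrySubst×ᵀ classes (Theorems/ProjOptimalUniqu. The file is kept as the record of this route; refuted decls are indexed as negative knowledge (`ledger negatives`).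

# Route ProjectionStability — stability method with rigidity INSIDE the induction —
Grenet-optimality and uniqueness of DET-projections of per_n propagate together from a finite base

LENS 3.4 decomposition-first (cycle 1) on the B-ceiling route ProjectionRigidity. X = that route's
Target — Grenet is optimal among
PROJECTIONS of the determinant: 2^n − 1 ≤ pdc(per_n) for every n ≥ 3 (pdc =
`detProjectionComplexity`, Valiant's measure: every cell a
variable or a constant) — together with its deciding crux ProjOptimalUnique (optimal projections are
unique modulo constant gauge
GL_m × GL_m, the symmetries of per_n and transposition, for ALL n), whose judged key risk is exactly
its GLOBAL form ("a single
non-Grenet optimal projection at n = 4 voids the global uniqueness antecedent and with it the whole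
induction"). TYPED SPLIT (local
statement + proved local-to-global, finite base): with Opt n := 2^n − 1 ≤ pdc(per_n) and Uniq n :=
uniqueness of optimal projections of
per_n, X ∧ ProjOptimalUnique ⇐ UniqBase (Uniq 3, finite) + UniqStep (∀ n ≥ 3, Opt n → Uniq n → Opt
(n+1) → Uniq (n+1)) + OptStep
(∀ n ≥ 3, Opt n → Uniq n → Opt (n+1)); the implication `X_of_subs` is PROVED (Sketch.lean,
sorry-free: induction on the strengthened
invariant Opt n ∧ Uniq n from the in-tree base Opt 3 = Alper–Bogart–Velasco) and `closes` composes
it with the parent's glue. No card is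
realised (the parent realises none either).
Lean: `∀ n ≥ 3, 2 ^ n - 1 ≤ Literature.Computability.AlgebraicComplexity.detProjectionComplexity
(Literature.Computability.AlgebraicComplexity.perPoly (Fin n) ℂ)`

## Assembly
Sorry-free in glue.lean = Sketch.lean `closes (hB : UniqBase) (hU : UniqStep) (hO : OptStep) (hQ :
PdcQpOfVp) : ValiantsHypothesis`:
(1) Opt 3 from the tree (7 ≤ dc(per_3) ≤ pdc(per_3):
`AlperBogartVelasco.exists_subspace_of_isAffineDetRepr_perPoly`,
`finrank_le_three_of_subperm_two_vanish`,
`determinantalComplexity_le_detProjectionComplexity_holds`); (2) THE SPLIT: `Nat.le_induction` on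
the
strengthened invariant Opt n ∧ Uniq n — base ⟨Opt 3, UniqBase⟩, step ⟨OptStep, UniqStep⟩ — gives
Target (and global uniqueness); (3) the
parent's glue verbatim: the gap point n = 2^(2^j − c) makes n ↦ pdc(per_n) not quasi-polynomially
bounded, contradicting PdcQpOfVp if per
were a VP family; `Hub.valiantsHypothesis_of_not_isVPFamily_per` with `mem_VP_ofFintype_iff_holds`,
`perFamily_mem_VNP_holds ℂ`.

Rationale: WHY THIS LINE. The parent runs the Simonovits/Keevash stability template (exact → unique →
bootstrap; Keevash2011 §5) in Valiant's projection model, where the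
polynomial Koszul gauge that refuted the affine version (negatives stmt-3735/3738) provably cannot
act — but it types uniqueness as an
UNCONDITIONAL crux for every n and lets the doubling consume it globally, although its own proof
plan for the doubling only ever uses
uniqueness at level n (to recognise the Laplace restrictions of an optimal (n+1)-projection as
Grenet_n-cored windows, HuttenhainIkenmeyer2016
§4). The stability method's actual architecture carries extremal-uniqueness INSIDE the induction:
exactness at n+1 and uniqueness at n+1 are
proved from (exactness, uniqueness) at n by the same restriction analysis. This route types exactly
that: the global crux disappears, the
finite base Uniq 3 (HI16 Prop. 9 for 0/1 constants; pdc(per_3) = 7 by Grenet +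
AlperBogartVelasco2017) becomes load-bearing and is handed to
certified computation, and the two one-step statements inherit the induction hypothesis as a tool —
for UniqStep the engine is the
commutative shadow of Nisan's layer-rank argument (Nisan1991; IkenmeyerLandsberg2017 Thm. 2.4:
Grenet is the unique-width optimum 2^m − 1 among
column-multilinear IMM presentations, optimal layers are bases of coefficient spaces, hence unique
up to layer gauge). Imported area:
extremal combinatorics (stability method) as proof ARCHITECTURE, algebraic branching programs
(Nisan) as the rigidity engine; the bridge to the
summit (VP ⇒ pdc quasi-polynomial: ValiantSTOC1979 Thm. 1, Burgisser2000 Prop. 2.30) is the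
parent's, shared by signature.

RANKED CRUXES. #0 Target (target) — X — Grenet is optimal among projections of DET: for every n ≥ 3,
2^n − 1 ≤ pdc(per_n) (= ProjectionRigidity.Target, shared item); derived inside `closes` from
UniqBase, UniqStep, OptStep together with global uniqueness. (why it might fail: far stronger than
VH (pdc = n^O(log n) is compatible with VP ≠ VNP); nothing beyond n²/2 ≤ dc ≤ pdc ≤ 2^n − 1 is known
and a 14×14 projection of per_4 kills it at once.) [Grenet2011, MignonRessayre2004,
AlperBogartVelasco2017, HuttenhainIkenmeyer2016, LandsbergRessayre2017]
#2 UniqStep (crux) — RIGIDITY PROPAGATES (Sub₂, carries the new difficulty): for every n ≥ 3, if 2^n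
− 1 ≤ pdc(per_n), optimal projections of per_n are unique modulo constant gauge × G_per × transpose,
and 2^(n+1) − 1 ≤ pdc(per_(n+1)), then optimal projections of per_(n+1) are unique in the same
sense. Weaker than the parent's ProjOptimalUnique (which it replaces); the induction hypothesis
classifies every Laplace restriction of an optimal (n+1)-projection as a Grenet_n-cored window, and
n+1 overlapping cores in known position are to pin the matrix up to gauge (finite patching; Nisan
layer-uniqueness as engine). [difficulty: XL] (why it might fail: a second constant-gauge orbit of
optimal projections at one level n+1 ≥ 4 — a pure Koszul twist of Grenet_(n+1) whose sign cocycle is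
a coboundary, or a cancellative non-ABP pattern — refutes it at that n even with level n classified;
evidence is binary and n = 3 only (HI16).) [Nisan1991, IkenmeyerLandsberg2017, arXiv:1610.00159,
HuttenhainIkenmeyer2016, arXiv:1410.8202, Keevash2011, LandsbergRessayre2017]
#3 OptStep (crux) — LAPLACE DOUBLING WITH LOCAL UNIQUENESS (Sub₃): for every n ≥ 3,
Grenet-optimality and uniqueness of optimal projections at level n imply 2^(n+1) − 1 ≤
pdc(per_(n+1)). Stronger than the parent's ProjLaplaceDoubling (only level-n uniqueness is
available) — which is what its proof plan (window reduction of the (n+1)² Laplace restrictions to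
optimal cores, relabelled Grenet_n by uniqueness; core packing by sub-permanent labels forces ≥
2·(2^n − 1) + 1 rows) actually delivers. [difficulty: XL] (why it might fail: a ≤ 14×14 projection
of per_4 kills it at n = 3; the window reduction of restricted (non-optimal) projections to optimal
cores is HI16-empirical (binary, n = 3) and cancelling cycle covers may leave "vertex computes a
sub-permanent" without meaning.) [Grenet2011, HuttenhainIkenmeyer2016, arXiv:1410.8202, Nisan1991,
Keevash2011, LandsbergRessayre2017]
#4 UniqBase (crux) — FINITE BASE (Sub₁, handed to certified computation / lens 3.5): any two optimal
projections of per_3 (size pdc(per_3), = 7 by Grenet + ABV) with det = per_3 are equivalent under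
GL(ℂ)-gauge, G_per and transposition — the n = 3 instance of the parent's ProjOptimalUnique; equals
ProjectionRigidity.ProjOptimalUniqueThree (7×7 form, stmt-16004) once pdc(per_3) = 7 lands (birth
skeleton UniqBase_of, proved). Binary case = HI16 Prop. 9 (463 matrices, one orbit); complex
constants by pattern enumeration with symbolic constants. [difficulty: L] (why it might fail: HI16
Prop. 9 covers 0/1 constants only: a 7×7 pattern with genuinely complex constants outside the Grenet
orbit refutes it (HI16 Example 10 shows dense integer-gauge-equivalent patterns exist, so the orbit
bookkeeping is delicate).) [HuttenhainIkenmeyer2016, arXiv:1410.8202, AlperBogartVelasco2017,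
Grenet2011]
#5 PdcQpOfVp (crux) — THE BRIDGE (parent's glue, shared item stmt-16003): if the permanent family is
a VP family then n ↦ pdc(per_n) is quasi-polynomially bounded (VP ⇒ dc quasi-polynomial is in tree,
`isQPBounded_determinantalComplexity_of_isVPFamily_holds`; affine → projection by the
Schur-complement expansion det [[A₀,U],[V,I]] = det(A₀ − UV) at cost ·(n²+1) — birth skeleton
PdcQpOfVp_of, proved modulo those two stubs). Known mathematics; ranked last. [difficulty: L] (why
it might fail: none mathematically (ValiantSTOC1979 Thm 1; Burgisser2000 Prop 2.30 / Cor 2.28;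
Schur-complement expansion); the risk is Lean cost only — the expansion gadget is not yet in the
tree.) [ValiantSTOC1979, Burgisser2000, arXiv:2406.06217]
#9 BootstrapAtThree (support) — the decisive finite instance n = 3 → 4 of BOTH steps (given the
in-tree Opt 3): uniqueness at 3 implies pdc(per_4) ≥ 15 AND uniqueness of optimal projections of
per_4 — the judge's "what would move it" (PdcPerFour + one orbit at n = 4); implied by UniqStep ∧
OptStep (Sketch: bootstrapAtThree_of_steps); certifiable / refutable by kit-sized search (HI16
pipeline with symbolic constants; SAT hunt for a 14×14 projection of per_4). [difficulty: XL]
[HuttenhainIkenmeyer2016, AlperBogartVelasco2017, Grenet2011]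

TWO-LAYER PLAN. Foreseen glued splits (k ≤ 3, depth 1; the birth skeletons bc/*_birth.lean already
type the first cut of each): OptStep ⇐ ProjectionPadding
(IsDetProjection f m → m ≤ m' → IsDetProjection f m', provable-now) → NoProjectionOneBelow (given
level n: per_(n+1) is not a projection of
DET_(2^(n+1) − 2)) → OptStep [proved: OptStep_of]; then NoProjectionOneBelow ⇐ WindowReduction
(every projection of per_n of size ≤ 2·pdc(per_n)+1
is constant-gauge block-triangular over an optimal core, unit pivots Laplaced away) → CorePacking
(the n+1 Grenet_n cores of one row cover
≥ 2^(n+1) − 2 rows). UniqStep ⇐ GrenetProjection (parent's stmt-16006, provable-now) →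
UniqStepAtGrenetSize (the statement at the explicit
size 2^(n+1) − 1) [proved: UniqStep_of]; then ⇐ WindowReduction → CorePinning (n+1 cores in Laplace
position determine the matrix up to
gauge; Nisan layer bases). UniqBase ⇐ PdcPerThree (pdc(per_3) = 7) → ProjOptimalUniqueThree
(parent's stmt-16004, 7×7) [proved: UniqBase_of].
PdcQpOfVp ⇐ AffineToProjection (Schur-complement expansion, cost ·(n²+1)) → QpClosedUnderPolyFactor
[proved: PdcQpOfVp_of].

KILL CRITERIA. A projection of per_4 of size ≤ 14 refutes OptStep (at n = 3), BootstrapAtThree and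
Target: close `refuted:OptStep` (VH survives elsewhere).
A second GL²×G_per×ᵀ-orbit of 7×7 projections of per_3 with complex constants refutes UniqBase: ONE
restate of the base to n₀ = 4
(UniqBase₄ + PdcPerFour as the finite base) if the extra orbit is visibly sporadic, else close
`refuted:UniqBase`. A second optimal orbit at
n = 4 with pdc(per_4) = 15 refutes UniqStep at n = 3: pivot ONLY if the extra orbit is
Grenet_3-cored (restate UniqStep to "unique up to the
list of cored orbits", OptStep unchanged), else close `refuted:UniqStep`. pdc(per_n) = 2^o(n) proved
anywhere refutes Target — close.
ProjectionRigidity's ProjOptimalUnique ∧ ProjLaplaceDoubling proved, DetQP.DetqpThesis, or any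
exponential dc bound elsewhere supersedes the route.

NOT DECOMPOSED YET. WindowReduction / CorePacking / CorePinning (the mechanism inside both steps)
are layer-2 children for tenure, exactly as in the parent; the
projection-entry predicate "X v ∨ C c" stays inlined (no definition item); signed/toric projections
(entries c·x) stay EXCLUDED (uniqueness
is false there at n = 4 by the pure Koszul twist, parent NOTES §Dodge (iii)); the induction starts
at n₀ = 3 because Opt 3 is the only
in-tree base — a sporadic failure at small n is repaired by moving n₀ (finite base to lens 3.5), not
by re-wording the steps.

CHEAPEST FALSIFIER. RAN here: (a) the split itself — `X_of_subs`, `invariant_of_subs`, `closes`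
elaborate sorry-free (Sketch.lean rc 0); (b) BC5: the n = 2 instance
of OptStep's shape (Opt 2 → Uniq 2 → Opt 3) holds outright from ABV (bc/special.lean, no sorry); (c)
the restriction mechanism at n = 3, 4 in
exact arithmetic (compute/grenet_restrict.py, this folder): the Laplace restriction x_(n+1,n+1) := 1
of Grenet_(n+1) is a projection of per_n
whose live core, after deleting unreachable/co-unreachable vertices (constant-gauge
block-triangular, unit-diagonal junk) and one unit-pivot
Laplace step, is Grenet_n of size 2^n − 1 — see NOTES.md for the output. NOT run (kit-size, refuter
first): 7×7 pattern enumeration with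
symbolic complex constants (UniqBase); SAT/numerical hunt for a 14×14 projection of per_4 or a
non-Grenet optimal 15×15 one (BootstrapAtThree).

NUMBERS. dc(per_3) = pdc(per_3) = 7 (AlperBogartVelasco2017 Cor. 1.4 + Grenet; lower half in tree);
9 ≤ dc(per_4) ≤ pdc(per_4) ≤ 15; n²/2 ≤ dc ≤ pdc ≤
2^n − 1 (MignonRessayre2004, Grenet2011). Binary 7×7 projections of per_3: 463, ONE orbit (HI16
Prop. 9). Column-multilinear IMM width of
per_m: exactly 2^m − 1 (Nisan1991 / IkenmeyerLandsberg2017 Thm. 2.4). Items at open: 7 (target, 4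
cruxes, 1 support, assembly); closes binders: 4.

DEFINITION REQUESTS. None at open: `detProjectionComplexity`, `IsDetProjection`, `perPoly`,
`permSymmetrySubst`, `Matrix.linSubstEntries`, `IsVPFamily`, `IsQPBounded`
exist (lean search --decl). Nice-to-have later (with the layer-2 children): a named predicate
`IsProjectionMatrix A` for "every entry X v or
C c" and `UniqueOptimalProjection n` to shorten the inlined signatures.

Novelty: Searches (2026-08-17): `ledger negatives --problem ValiantsHypothesis` (4: 5668, 0340, 3735, 3738 —
affine model); read Theses/ProjectionRigidity.lean
and Theses/SchenstedIndex.lean in full + `ledger workitem get` of the parent (items 16000–16007 all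
open, closes certified); corpus
open_routes_cruxes.jsonl (33 routes: no route carries uniqueness inside an induction;
RigidMinimalReps / RigidityForcesSymmetry are affine-model
rigidity ⇒ symmetry lines); `lit search --source zbmath "determinantal complexity permanent"` (14:
HI16 arXiv:1410.8202, IkenmeyerLandsberg2017
arXiv:1610.00159, LandsbergRessayre2017, MignonRessayre2004, ABV, Qiao–Sun–Yu field extensions …);
`lit read arxiv:1610.00159` (pp. 3–4, 7:
Thm. 2.4 column-multilinear IMM optimum 2^m − 1 = Grenet, Nisan's layer-rank proof; rdc = dc for per
by von zur Gathen); `lit galaxy search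
"determinantal complexity of the permanent Grenet optimal" | "binary determinantal complexity" |
"optimality and uniqueness simultaneously by
induction" | "algebraic branching program permanent lower bound uniqueness optimal width Nisan" |
"lower bounds for non-commutative computation"
--star all` (0, 0, 0, 0, 1 irrelevant Dagstuhl report); local searchd / OpenAlex / arXiv API
unavailable this session (connection reset, HTTP 429 ×2).
Nearest prior art found: the hub's own route ProjectionRigidity (same model, same X, global
uniqueness crux — the parent of this split);
HuttenhainIkenmeyer2016 (arXiv:1410.8202 Prop. 9: uniqueness at (3,7) bin  [refs: 1410.8202, 1610.00159, arxiv:1610.00159, IkenmeyerLandsberg2017, LandsbergRessayre2017, MignonRessayre2004, HuttenhainIkenmeyer2016, Nisan1991, Keevash2011]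

Barriers (technique_class: stability-method, rigidity, projection-model, induction): - technique_class: stability-method, rigidity, projection-model, induction
- Literature.Barriers.ValiantsHypothesis.AlgebraicNaturalProofs: the argument quantifies over
representations of per_n only (uniqueness of an extremiser, an induction on n) and defines no
property of all polynomials of small pdc — not a distinguisher in the sense of
`NaturalProofAgainstVP`; conceded: no largeness leverage, and "pdc ≤ m" is constructible in the
coefficients of per for fixed m like every dc-type bound.
- Literature.Barriers.ValiantsHypothesis.PermanentCharTwo: everything is over ℂ; in characteristic 2
per = det has pdc = n, Opt n is false from n = 3 and uniqueness fails (moduli of optimal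
expressions); the sign obstruction excluding pure Koszul twists disappears exactly in characteristic
2 — the line is characteristic-sensitive by construction, as it must be.
- Literature.Barriers.ValiantsHypothesis.RankMethods: no rank / flattening / shifted-partials
measure is applied to per_n versus det_m; Nisan's layer rank enters only INSIDE the uniqueness
engine for a fixed optimal projection (coefficient spaces of one ABP), not as a separating measure,
so the rank-saturation barriers (incl. the 2026 min-partition-rank barrier for multilinear ABPs,
arXiv:2604.00746) are not engaged; the line's own risk is non-uniqueness.
- Literature.Barriers.ValiantsHypothesis.MonotoneGap: constants of both signs and cancelling cycle
covers are allowed (projections of DET are universal for VP up to quasi-polynomia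

History (route lifecycle, newest last):
- 2026-08-17T12:22:21Z · BROKEN — UniqBase (stmt-ValiantsHypothesis-17836, crux) refuted by Summit.ValiantsHypothesis.ValiantsHypothesis.Theorems.not_UniqBase @ 53947f98e527 (prover-line-stmt-ValiantsHypothesis-17836-0)
- 2026-08-17T12:49:16Z · CLOSED refuted — refuted:stmt-ValiantsHypothesis-17836 (UniqBase) by Summit.ValiantsHypothesis.ValiantsHypothesis.Theorems.not_UniqBase (planner-rfix-ValiantsHypothesis-ProjectionSt-9b502ec7-0)

sub-problem: ValiantsHypothesis · status: closed(refuted) · opened planner-plan-lens3-ValiantsHypothesis-decomp-0 2026-08-17T02:14:10Z · rev 1 · ledger route-ValiantsHypothesis-ProjectionStability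
GENERATED by the gate from the ledger (D-0016/17). Provers cite these decls: `theorem foo : Summit.ValiantsHypothesis.ValiantsHypothesis.Theses.ProjectionStability.<Decl> := …` in Summits/ValiantsHypothesis/ValiantsHypothesis/Theorems/<Name>.lean.
-/

namespace Summit.ValiantsHypothesis.ValiantsHypothesis.Theses.ProjectionStability

open scoped BigOperators Topology Manifold Classical MeasureTheory ProbabilityTheory Matrix InnerProductSpace ComplexConjugate ContinuousMap
open Filter Set Function TopologicalSpace MeasureTheory

attribute [summit_statement] _root_.ValiantsHypothesis

open Literature.PNP

/-- item stmt-ValiantsHypothesis-16000 · target · rank 0 · closed · moot by None · by planner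
why it might fail: far stronger than VH (pdc = n^O(log n) is compatible with VP ≠ VNP); nothing beyond n²/2 ≤ dc ≤ pdc ≤ 2^n − 1 is known and a 14×14 projection of per_4 kills it at once.
sources: Grenet2011, MignonRessayre2004, AlperBogartVelasco2017, HuttenhainIkenmeyer2016, LandsbergRessayre2017
[target] X — Grenet is optimal among projections of DET: for every n ≥ 3, 2^n − 1 ≤ pdc(per_n)
(hence = 2^n − 1 by GrenetProjection). -/
@[route_item "route-ValiantsHypothesis-ProjectionStability"]
def Target : Prop :=
  ∀ n ≥ 3, 2 ^ n - 1 ≤ Literature.Computability.AlgebraicComplexity.detProjectionComplexity (Literature.Computability.AlgebraicComplexity.perPoly (Fin n) ℂ)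

/-- item stmt-ValiantsHypothesis-17834 · crux · rank 2 · closed · moot by None · by planner
why it might fail: a second constant-gauge orbit of optimal projections at one level n+1 ≥ 4 — a pure Koszul twist of Grenet_(n+1) whose sign cocycle is a coboundary, or a cancellative non-ABP pattern — refutes it at that n even with level n classified; evidence is binary and n = 3 only (HI16).
sources: Nisan1991, IkenmeyerLandsberg2017, arXiv:1610.00159, HuttenhainIkenmeyer2016, arXiv:1410.8202, Keevash2011
[crux] RIGIDITY PROPAGATES (Sub₂, carries the new difficulty): for every n ≥ 3, if 2^n − 1 ≤
pdc(per_n), optimal projections of per_n are unique modulo constant gauge × G_per × transpose, and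
2^(n+1) − 1 ≤ pdc(per_(n+1)), then optimal projections of per_(n+1) are unique in the same sense.
Weaker than the parent's ProjOptimalUnique (which it replaces); the induction hypothesis classifies
every Laplace restriction of an optimal (n+1)-projection as a Grenet_n-cored window, and n+1
overlapping cores in known position are to pin the matrix up to gauge (finite patching; Nisan
layer-uniqueness as engine). [difficulty: XL] -/
@[route_item "route-ValiantsHypothesis-ProjectionStability"]
def UniqStep : Prop :=
  ∀ n ≥ 3, 2 ^ n - 1 ≤ Literature.Computability.AlgebraicComplexity.detProjectionComplexity (Literature.Computability.AlgebraicComplexity.perPoly (Fin n) ℂ) → (∀ A B : Matrix (Fin (Literature.Computability.AlgebraicComplexity.detProjectionComplexity (Literature.Computability.AlgebraicComplexity.perPoly (Fin n) ℂ))) (Fin (Literature.Computability.AlgebraicComplexity.detProjectionComplexity (Literature.Computability.AlgebraicComplexity.perPoly (Fin n) ℂ))) (MvPolynomial (Fin n × Fin n) ℂ), (∀ i j, (∃ v, A i j = MvPolynomial.X v) ∨ ∃ c, A i j = MvPolynomial.C c) → (∀ i j, (∃ v, B i j = MvPolynomial.X v) ∨ ∃ c, B i j = MvPolynomial.C c)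 → A.det = Literature.Computability.AlgebraicComplexity.perPoly (Fin n) ℂ → B.det = Literature.Computability.AlgebraicComplexity.perPoly (Fin n) ℂ → ∃ (P Q : GL (Fin (Literature.Computability.AlgebraicComplexity.detProjectionComplexity (Literature.Computability.AlgebraicComplexity.perPoly (Fin n) ℂ))) ℂ) (γ : GL (Fin n × Fin n) ℂ), γ ∈ Literature.Computability.AlgebraicComplexity.permSymmetrySubst ℂ n ∧ (B = (P : Matrix _ _ ℂ).map MvPolynomial.C * Literature.Computability.AlgebraicComplexity.Matrix.linSubstEntries γ A * (Q : Matrix _ _ ℂ).map MvPolynomial.C ∨ B = (P : Matrix _ _ ℂ).map MvPolynomial.C * (Literature.Computability.AlgebraicComplexity.Matrix.linSubstEntries γ A).transpose * (Q : Matrix _ _ ℂ).map MvPolynomial.C)) → 2 ^ (n + 1) - 1 ≤ Literature.Computability.AlgebraicComplexity.detProjectionComplexity (Literature.Computability.AlgebraicComplexity.perPoly (Fin (n + 1)) ℂ) → ∀ A B : Matrix (Fin (Literature.Computability.AlgebraicComplexity.detProjectionComplexity (Literature.Computability.AlgebraicComplexity.perPoly (Fin (n + 1)) ℂ))) (Fin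 (Literature.Computability.AlgebraicComplexity.detProjectionComplexity (Literature.Computability.AlgebraicComplexity.perPoly (Fin (n + 1)) ℂ))) (MvPolynomial (Fin (n + 1) × Fin (n + 1)) ℂ), (∀ i j, (∃ v, A i j = MvPolynomial.X v) ∨ ∃ c, A i j = MvPolynomial.C c) → (∀ i j, (∃ v, B i j = MvPolynomial.X v) ∨ ∃ c, B i j = MvPolynomial.C c) → A.det = Literature.Computability.AlgebraicComplexity.perPoly (Fin (n + 1)) ℂ → B.det = Literature.Computability.AlgebraicComplexity.perPoly (Fin (n + 1)) ℂ → ∃ (P Q : GL (Fin (Literature.Computability.AlgebraicComplexity.detProjectionComplexity (Literature.Computability.AlgebraicComplexity.perPoly (Fin (n + 1)) ℂ))) ℂ) (γ : GL (Fin (n + 1) × Fin (n + 1)) ℂ), γ ∈ Literature.Computability.AlgebraicComplexity.permSymmetrySubst ℂ (n + 1) ∧ (B = (P : Matrix _ _ ℂ).map MvPolynomial.C * Literature.Computability.AlgebraicComplexity.Matrix.linSubstEntries γ A * (Q : Matrix _ _ ℂ).map MvPolynomial.C ∨ B = (P : Matrix _ _ ℂ).map MvPolynomial.C * (Literature.Computability.AlgebraicComplexity.Matrix.linSubstEntries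 γ A).transpose * (Q : Matrix _ _ ℂ).map MvPolynomial.C)

/-- item stmt-ValiantsHypothesis-17835 · crux · rank 3 · closed · moot by None · by planner
why it might fail: a ≤ 14×14 projection of per_4 kills it at n = 3; the window reduction of restricted (non-optimal) projections to optimal cores is HI16-empirical (binary, n = 3) and cancelling cycle covers may leave "vertex computes a sub-permanent" without meaning.
sources: Grenet2011, HuttenhainIkenmeyer2016, arXiv:1410.8202, Nisan1991, Keevash2011, LandsbergRessayre2017
[crux] LAPLACE DOUBLING WITH LOCAL UNIQUENESS (Sub₃): for every n ≥ 3, Grenet-optimality and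
uniqueness of optimal projections at level n imply 2^(n+1) − 1 ≤ pdc(per_(n+1)). Stronger than the
parent's ProjLaplaceDoubling (only level-n uniqueness is available) — which is what its proof plan
(window reduction of the (n+1)² Laplace restrictions to optimal cores, relabelled Grenet_n by
uniqueness; core packing by sub-permanent labels forces ≥ 2·(2^n − 1) + 1 rows) actually delivers.
[difficulty: XL] -/
@[route_item "route-ValiantsHypothesis-ProjectionStability"]
def OptStep : Prop :=
  ∀ n ≥ 3, 2 ^ n - 1 ≤ Literature.Computability.AlgebraicComplexity.detProjectionComplexity (Literature.Computability.AlgebraicComplexity.perPoly (Fin n) ℂ) → (∀ A B : Matrix (Fin (Literature.Computability.AlgebraicComplexity.detProjectionComplexity (Literature.Computability.AlgebraicComplexity.perPoly (Fin n) ℂ))) (Fin (Literature.Computability.AlgebraicComplexity.detProjectionComplexity (Literature.Computability.AlgebraicComplexity.perPoly (Fin n) ℂ))) (MvPolynomial (Fin n × Fin n) ℂ), (∀ i j, (∃ v, A i j = MvPolynomial.X v) ∨ ∃ c, A i j = MvPolynomial.C c) → (∀ i j, (∃ v, B i j = MvPolynomial.X v) ∨ ∃ c, B i j = MvPolynomial.C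 c) → A.det = Literature.Computability.AlgebraicComplexity.perPoly (Fin n) ℂ → B.det = Literature.Computability.AlgebraicComplexity.perPoly (Fin n) ℂ → ∃ (P Q : GL (Fin (Literature.Computability.AlgebraicComplexity.detProjectionComplexity (Literature.Computability.AlgebraicComplexity.perPoly (Fin n) ℂ))) ℂ) (γ : GL (Fin n × Fin n) ℂ), γ ∈ Literature.Computability.AlgebraicComplexity.permSymmetrySubst ℂ n ∧ (B = (P : Matrix _ _ ℂ).map MvPolynomial.C * Literature.Computability.AlgebraicComplexity.Matrix.linSubstEntries γ A * (Q : Matrix _ _ ℂ).map MvPolynomial.C ∨ B = (P : Matrix _ _ ℂ).map MvPolynomial.C * (Literature.Computability.AlgebraicComplexity.Matrix.linSubstEntries γ A).transpose * (Q : Matrix _ _ ℂ).map MvPolynomial.C)) → 2 ^ (n + 1) - 1 ≤ Literature.Computability.AlgebraicComplexity.detProjectionComplexity (Literature.Computability.AlgebraicComplexity.perPoly (Fin (n + 1)) ℂ)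

/-- item stmt-ValiantsHypothesis-17836 · crux · rank 4 · closed · refuted by Summit.ValiantsHypothesis.ValiantsHypothesis.Theorems.not_UniqBase @ 53947f98e527 (prover) · by planner
why it might fail: HI16 Prop. 9 covers 0/1 constants only: a 7×7 pattern with genuinely complex constants outside the Grenet orbit refutes it (HI16 Example 10 shows dense integer-gauge-equivalent patterns exist, so the orbit bookkeeping is delicate).
sources: HuttenhainIkenmeyer2016, arXiv:1410.8202, AlperBogartVelasco2017, Grenet2011
[crux] FINITE BASE (Sub₁, handed to certified computation / lens 3.5): any two optimal projections
of per_3 (size pdc(per_3), = 7 by Grenet + ABV) with det = per_3 are equivalent under GL(ℂ)-gauge,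
G_per and transposition — the n = 3 instance of the parent's ProjOptimalUnique; equals
ProjectionRigidity.ProjOptimalUniqueThree (7×7 form, stmt-16004) once pdc(per_3) = 7 lands (birth
skeleton UniqBase_of, proved). Binary case = HI16 Prop. 9 (463 matrices, one orbit); complex
constants by pattern enumeration with symbolic constants. [difficulty: L] -/
@[route_item "route-ValiantsHypothesis-ProjectionStability"]
def UniqBase : Prop :=
  ∀ A B : Matrix (Fin (Literature.Computability.AlgebraicComplexity.detProjectionComplexity (Literature.Computability.AlgebraicComplexity.perPoly (Fin 3) ℂ))) (Fin (Literature.Computability.AlgebraicComplexity.detProjectionComplexity (Literature.Computability.AlgebraicComplexity.perPoly (Fin 3) ℂ))) (MvPolynomial (Fin 3 × Fin 3) ℂ), (∀ i j, (∃ v, A i j = MvPolynomial.X v) ∨ ∃ c, A i j = MvPolynomial.C c) → (∀ i j, (∃ v, B i j = MvPolynomial.X v) ∨ ∃ c, B i j = MvPolynomial.C c) → A.det = Literature.Computability.AlgebraicComplexity.perPoly (Fin 3) ℂ → B.det = Literature.Computability.AlgebraicComplexity.perPoly (Fin 3) ℂ → ∃ (P Q : GL (Fin (Literature.Computability.AlgebraicComplexity.detProjectionComplexity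 (Literature.Computability.AlgebraicComplexity.perPoly (Fin 3) ℂ))) ℂ) (γ : GL (Fin 3 × Fin 3) ℂ), γ ∈ Literature.Computability.AlgebraicComplexity.permSymmetrySubst ℂ 3 ∧ (B = (P : Matrix _ _ ℂ).map MvPolynomial.C * Literature.Computability.AlgebraicComplexity.Matrix.linSubstEntries γ A * (Q : Matrix _ _ ℂ).map MvPolynomial.C ∨ B = (P : Matrix _ _ ℂ).map MvPolynomial.C * (Literature.Computability.AlgebraicComplexity.Matrix.linSubstEntries γ A).transpose * (Q : Matrix _ _ ℂ).map MvPolynomial.C)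

/-- item stmt-ValiantsHypothesis-16003 · crux · rank 5 · closed · proved by Summit.ValiantsHypothesis.ValiantsHypothesis.Theorems.ProjectionStabilityPdcQpOfVp.pdcQpOfVp_proof @ 7c8b420fa0e2 (prover) · by planner
why it might fail: none mathematically (ValiantSTOC1979 Thm 1; Burgisser2000 Prop 2.30 / Cor 2.28; Schur-complement expansion); the risk is Lean cost only — the expansion gadget is not yet in the tree.
sources: ValiantSTOC1979, Burgisser2000, arXiv:2406.06217
[crux] the bridge — if the permanent family is a VP family then n ↦ pdc(per_n) is quasi-polynomially
bounded (VP ⊆ VQP_e, tree `isVQPeFamily_iff_isVQPFamily`; a formula of size e is a projection of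
DET_{e+2}, Valiant 1979 Thm 1 — the tree's `exists_isDetProjection` gives existence without the size
bound, and `isQPBounded_determinantalComplexity_of_isVPFamily_holds` gives the AFFINE bound). Known
mathematics; ranked last; a hypothesis of `closes`. [difficulty: L] -/
@[route_item "route-ValiantsHypothesis-ProjectionStability"]
def PdcQpOfVp : Prop :=
  Literature.Computability.AlgebraicComplexity.IsVPFamily (fun n => Literature.Computability.AlgebraicComplexity.perPoly (Fin n) ℂ) → Literature.Computability.AlgebraicComplexity.IsQPBounded (fun n => Literature.Computability.AlgebraicComplexity.detProjectionComplexity (Literature.Computability.AlgebraicComplexity.perPoly (Fin n) ℂ))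

/-- item stmt-ValiantsHypothesis-17837 · support · rank 9 · closed · moot by None · by planner
sources: HuttenhainIkenmeyer2016, AlperBogartVelasco2017, Grenet2011
[support] the decisive finite instance n = 3 → 4 of BOTH steps (given the in-tree Opt 3): uniqueness
at 3 implies pdc(per_4) ≥ 15 AND uniqueness of optimal projections of per_4 — the judge's "what
would move it" (PdcPerFour + one orbit at n = 4); implied by UniqStep ∧ OptStep (Sketch:
bootstrapAtThree_of_steps); certifiable / refutable by kit-sized search (HI16 pipeline with symbolic
constants; SAT hunt for a 14×14 projection of per_4). [difficulty: XL] -/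
@[route_item "route-ValiantsHypothesis-ProjectionStability"]
def BootstrapAtThree : Prop :=
  (∀ A B : Matrix (Fin (Literature.Computability.AlgebraicComplexity.detProjectionComplexity (Literature.Computability.AlgebraicComplexity.perPoly (Fin 3) ℂ))) (Fin (Literature.Computability.AlgebraicComplexity.detProjectionComplexity (Literature.Computability.AlgebraicComplexity.perPoly (Fin 3) ℂ))) (MvPolynomial (Fin 3 × Fin 3) ℂ), (∀ i j, (∃ v, A i j = MvPolynomial.X v) ∨ ∃ c, A i j = MvPolynomial.C c) → (∀ i j, (∃ v, B i j = MvPolynomial.X v) ∨ ∃ c, B i j = MvPolynomial.C c) → A.det = Literature.Computability.AlgebraicComplexity.perPoly (Fin 3) ℂ → B.det = Literature.Computability.AlgebraicComplexity.perPoly (Fin 3) ℂ → ∃ (P Q : GL (Fin (Literature.Computability.AlgebraicComplexity.detProjectionComplexity (Literature.Computability.AlgebraicComplexity.perPoly (Fin 3) ℂ))) ℂ) (γ : GL (Fin 3 × Fin 3) ℂ), γ ∈ Literature.Computability.AlgebraicComplexity.permSymmetrySubst ℂ 3 ∧ (B = (P : Matrix _ _ ℂ).map MvPolynomial.C * Literature.Computability.AlgebraicComplexity.Matrix.linSubstEntries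 γ A * (Q : Matrix _ _ ℂ).map MvPolynomial.C ∨ B = (P : Matrix _ _ ℂ).map MvPolynomial.C * (Literature.Computability.AlgebraicComplexity.Matrix.linSubstEntries γ A).transpose * (Q : Matrix _ _ ℂ).map MvPolynomial.C)) → 2 ^ 4 - 1 ≤ Literature.Computability.AlgebraicComplexity.detProjectionComplexity (Literature.Computability.AlgebraicComplexity.perPoly (Fin 4) ℂ) ∧ ∀ A B : Matrix (Fin (Literature.Computability.AlgebraicComplexity.detProjectionComplexity (Literature.Computability.AlgebraicComplexity.perPoly (Fin 4) ℂ))) (Fin (Literature.Computability.AlgebraicComplexity.detProjectionComplexity (Literature.Computability.AlgebraicComplexity.perPoly (Fin 4) ℂ))) (MvPolynomial (Fin 4 × Fin 4) ℂ), (∀ i j, (∃ v, A i j = MvPolynomial.X v) ∨ ∃ c, A i j = MvPolynomial.C c) → (∀ i j, (∃ v, B i j = MvPolynomial.X v) ∨ ∃ c, B i j = MvPolynomial.C c) → A.det = Literature.Computability.AlgebraicComplexity.perPoly (Fin 4) ℂ → B.det = Literature.Computability.AlgebraicComplexity.perPoly (Fin 4) ℂ → ∃ (P Q : GL (Fin (Literature.Computability.AlgebraicComplexity.detProjectionComplexity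 (Literature.Computability.AlgebraicComplexity.perPoly (Fin 4) ℂ))) ℂ) (γ : GL (Fin 4 × Fin 4) ℂ), γ ∈ Literature.Computability.AlgebraicComplexity.permSymmetrySubst ℂ 4 ∧ (B = (P : Matrix _ _ ℂ).map MvPolynomial.C * Literature.Computability.AlgebraicComplexity.Matrix.linSubstEntries γ A * (Q : Matrix _ _ ℂ).map MvPolynomial.C ∨ B = (P : Matrix _ _ ℂ).map MvPolynomial.C * (Literature.Computability.AlgebraicComplexity.Matrix.linSubstEntries γ A).transpose * (Q : Matrix _ _ ℂ).map MvPolynomial.C)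

/-- item stmt-ValiantsHypothesis-17838 · assembly · rank 1 · closed · moot by None · by planner
sources: Keevash2011, ValiantSTOC1979, AlperBogartVelasco2017
[assembly] UniqBase → UniqStep → OptStep → PdcQpOfVp → ValiantsHypothesis (exactly `closes`). -/
@[route_item "route-ValiantsHypothesis-ProjectionStability"]
def Assembly : Prop :=
  UniqBase → UniqStep → OptStep → PdcQpOfVp → ValiantsHypothesis

end Summit.ValiantsHypothesis.ValiantsHypothesis.Theses.ProjectionStability
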